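import Mathlib
import Summits.Ventures.PercRepro2.Defs
import Summits.Ventures.PercRepro2.Independence
import Summits.Ventures.PercRepro2.Graph
import Summits.Ventures.PercRepro2.Induced
import Summits.Ventures.PercRepro2.HullDefs
import Summits.Ventures.PercRepro2.HullFlip
import Summits.Ventures.PercRepro2.HullPieceFlip

/-!
# The SAME-kernel piece flip: a total map `M₁ → P₁`, and an involution on its stable part
(blind cell PercRepro2, mine-1 g10; `proofs/MINE1-SAMEKERNEL-FRAME.md` §1–§2)

Same-side kernel of a root `l` and two vertices `x`, `y`:
`M₁ = {x ∈ R_side, y ∈ B_side}` (opposite sides), `P₁ = {x, y ∈ R_side}` (same side).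
For `ζ ∈ M₁` let `P := piece ζ l y` (the component of `y` in the graph induced on `hull ∖ core`,
edges of both colours) and `ζ′ := flip P ζ`. From typer-1's / mine-2's `HullPieceFlip`
(`cluster_flip_bside_eq`, `cluster_blue_flip_bside_subset`):

* `sameFlip_total`: `ζ′ ∈ P₁` — `x` and `y` both lie on the red side of `ζ′`; the hull and the core
  do not grow (`hull_flip_bside_subset`, `core_flip_bside_subset`);
* `sideSign_mul_sameFlip`: the same-side kernel of `ζ′` is `+1`;
* the STABLE part: if the core does not change (`core ζ′ = core ζ`) then the hull does not change
  either (`hull_sameFlip_eq_of_core_eq`), the piece of `y` in `ζ′` is again `P`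
  (`piece_sameFlip_eq_of_core_eq`) and the flip of that piece returns `ζ`
  (`sameFlip_sameFlip_of_core_eq`): on core-stable configurations the same-kernel piece flip is
  an involution `M₁ ↔ P₁` of the (hull, core) fibre, hence injective there
  (`sameFlip_injOn_stable`).

The unstable part (`core ζ′ ⊊ core ζ`) is where the collisions of the total map live; see the
frame identity of `proofs/MINE1-SAMEKERNEL-FRAME.md`.
-/

namespace Summit.Ventures.PercRepro2

namespace Hull

variable {V : Type*} {E : Type*} {ends : E → Sym2 V} {ζ : Config E} {l x y : V}

/-- **The same-kernel piece flip is total**: for `x ∈ R_side` and `y ∈ B_side`, flipping the piece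
of `y` puts both `x` and `y` on the red side. -/
theorem sameFlip_total (hx : x ∈ rside ends ζ l) (hy : y ∈ bside ends ζ l) :
    x ∈ rside ends (flip ends (piece ends ζ l y) ζ) l ∧
      y ∈ rside ends (flip ends (piece ends ζ l y) ζ) l := by
  have hyP : y ∈ piece ends ζ l y := mem_piece_self ζ l y
  have hR := cluster_flip_bside_eq hy
  have hB := cluster_blue_flip_bside_subset hy
  refine ⟨⟨?_, ?_⟩, ⟨?_, ?_⟩⟩
  · rw [hR]; exact Or.inl hx.1
  · intro hxB; exact hx.2 (hB hxB).1
  · rw [hR]; exact Or.inr hyP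
  · intro hyB; exact (hB hyB).2 hyP

/-- The same-side kernel of the flipped configuration is `+1`. -/
theorem sideSign_mul_sameFlip (R : Type*) [Ring R] (hx : x ∈ rside ends ζ l)
    (hy : y ∈ bside ends ζ l) :
    sideSign R ends (flip ends (piece ends ζ l y) ζ) l x *
      sideSign R ends (flip ends (piece ends ζ l y) ζ) l y = 1 := by
  obtain ⟨hx', hy'⟩ := sameFlip_total hx hy
  have hxB : x ∉ bside ends (flip ends (piece ends ζ l y) ζ) l := fun h => h.2 hx'.1
  have hyB : y ∉ bside ends (flip ends (piece ends ζ l y) ζ) l := fun h => h.2 hy'.1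
  simp [sideSign, hx', hy', hxB, hyB]

/-- A blue neighbour (outside the piece) of a vertex of the piece of a blue-side vertex is a core
vertex. -/
lemma mem_core_of_blue_edge_piece (hy : y ∈ bside ends ζ l) {a b : V} {e : E}
    (ha : a ∈ piece ends ζ l y) (hb : b ∉ piece ends ζ l y) (he : blue ζ e = true)
    (hends : ends e = s(a, b)) : b ∈ core ends ζ l := by
  have haB : a ∈ cluster ends (blue ζ) l := piece_subset_cluster_blue hy ha
  have hbB : b ∈ cluster ends (blue ζ) l := mem_cluster_of_edge haB he hends
  by_contra hbK
  have hbS : b ∈ bside ends ζ l := ⟨hbB, fun hbR => hbK ⟨hbR, hbB⟩⟩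
  have hyH : y ∈ hull ends ζ l \ core ends ζ l :=
    ⟨Or.inr hy.1, fun h => hy.2 h.1⟩
  have haH : a ∈ hull ends ζ l \ core ends ζ l := piece_subset hyH ha
  have hbH : b ∈ hull ends ζ l \ core ends ζ l := ⟨Or.inr hbB, fun h => hbS.2 h.1⟩
  exact hb (mem_piece_of_edge ha haH hbH hends)

/-- If the core survives the flip of the piece of a blue-side vertex, the blue cluster of `l` loses
nothing but the piece: `C_B(l) ⊆ C_B^{ζ′}(l) ∪ P`. -/
theorem cluster_blue_subset_sameFlip_of_core_eq (hy : y ∈ bside ends ζ l)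
    (hc : core ends (flip ends (piece ends ζ l y) ζ) l = core ends ζ l) :
    cluster ends (blue ζ) l ⊆
      cluster ends (blue (flip ends (piece ends ζ l y) ζ)) l ∪ piece ends ζ l y := by
  intro v hv
  refine mem_of_conn_of_closed (ends := ends) (ω := blue ζ) ?_ ?_ hv
  · intro a ha b hab
    obtain ⟨hne, e, he, hends⟩ := exists_edge_of_adj hab
    by_cases hbP : b ∈ piece ends ζ l y
    · exact Or.inr hbP
    rcases ha with ha | ha
    · -- `a` is already in the new blue cluster; the edge `e` keeps its colour unless it touches `P`
      by_cases heP : e ∈ touches ends (piece ends ζ l y)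
      · -- the edge touches `P` but `b ∉ P`, so `a ∈ P` — impossible for a vertex of the new blue cluster
        exfalso
        rcases (mem_touches_iff_of_ends hends).1 heP with haP | hbP'
        · exact (cluster_blue_flip_bside_subset hy ha).2 haP
        · exact hbP hbP'
      · left
        have he' : blue (flip ends (piece ends ζ l y) ζ) e = true := by
          rw [blue_flip, flip_apply_of_notMem heP]; exact he
        exact mem_cluster_of_edge ha he' hends
    · -- `a ∈ P`: its blue neighbour `b ∉ P` is a core vertex, and the core is stable
      left
      have hbK : b ∈ core ends ζ l := mem_core_of_blue_edge_piece hy ha hbP he hends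
      rw [← hc] at hbK
      exact hbK.2
  · exact Or.inl (mem_cluster_self _ _ _)

/-- If the core survives the flip of the piece of a blue-side vertex, so does the hull. -/
theorem hull_sameFlip_eq_of_core_eq (hy : y ∈ bside ends ζ l)
    (hc : core ends (flip ends (piece ends ζ l y) ζ) l = core ends ζ l) :
    hull ends (flip ends (piece ends ζ l y) ζ) l = hull ends ζ l := by
  refine Set.Subset.antisymm (hull_flip_bside_subset hy) ?_
  rintro v (hv | hv)
  · left; rw [cluster_flip_bside_eq hy]; exact Or.inl hv
  · rcases cluster_blue_subset_sameFlip_of_core_eq hy hc hv with hv' | hv'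
    · exact Or.inr hv'
    · left; rw [cluster_flip_bside_eq hy]; exact Or.inr hv'

/-- The free configuration depends on `ζ` only through `hull ∖ core`. -/
lemma freeConfig_eq_of_hull_core_eq {ζ' : Config E}
    (hh : hull ends ζ' l = hull ends ζ l) (hc : core ends ζ' l = core ends ζ l) :
    freeConfig ends ζ' l = freeConfig ends ζ l := by
  have hw : within ends (hull ends ζ' l \ core ends ζ' l) =
      within ends (hull ends ζ l \ core ends ζ l) := by rw [hh, hc]
  funext e
  simp only [freeConfig]
  rw [hw]

/-- The piece of a vertex depends on `ζ` only through `hull ∖ core`. -/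
lemma piece_eq_of_hull_core_eq {ζ' : Config E} (o : V)
    (hh : hull ends ζ' l = hull ends ζ l) (hc : core ends ζ' l = core ends ζ l) :
    piece ends ζ' l o = piece ends ζ l o := by
  simp only [piece, freeConfig_eq_of_hull_core_eq hh hc]

/-- On a core-stable configuration the piece of `y` after the flip is the piece of `y` before. -/
theorem piece_sameFlip_eq_of_core_eq (hy : y ∈ bside ends ζ l)
    (hc : core ends (flip ends (piece ends ζ l y) ζ) l = core ends ζ l) :
    piece ends (flip ends (piece ends ζ l y) ζ) l y = piece ends ζ l y :=
  piece_eq_of_hull_core_eq y (hull_sameFlip_eq_of_core_eq hy hc) hc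

/-- **The stable same-kernel flip is an involution**: flipping the piece of `y` twice (the second
time in the flipped configuration) returns `ζ` whenever the core is stable. -/
theorem sameFlip_sameFlip_of_core_eq (hy : y ∈ bside ends ζ l)
    (hc : core ends (flip ends (piece ends ζ l y) ζ) l = core ends ζ l) :
    flip ends (piece ends (flip ends (piece ends ζ l y) ζ) l y)
      (flip ends (piece ends ζ l y) ζ) = ζ := by
  rw [piece_sameFlip_eq_of_core_eq hy hc, flip_flip]

/-- **Injectivity on the stable part**: two configurations with `y` on the blue side and a stable
flip of the piece of `y` that have the same image coincide. -/
theorem sameFlip_injOn_stable {ζ₁ ζ₂ : Config E} (h₁ : y ∈ bside ends ζ₁ l)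
    (h₂ : y ∈ bside ends ζ₂ l)
    (hc₁ : core ends (flip ends (piece ends ζ₁ l y) ζ₁) l = core ends ζ₁ l)
    (hc₂ : core ends (flip ends (piece ends ζ₂ l y) ζ₂) l = core ends ζ₂ l)
    (heq : flip ends (piece ends ζ₁ l y) ζ₁ = flip ends (piece ends ζ₂ l y) ζ₂) : ζ₁ = ζ₂ := by
  have e₁ := sameFlip_sameFlip_of_core_eq h₁ hc₁
  have e₂ := sameFlip_sameFlip_of_core_eq h₂ hc₂
  rw [heq] at e₁
  exact e₁.symm.trans e₂

end Hull

end Summit.Ventures.PercRepro2
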